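import Summits.FinalStateConjecture.FinalStateConjecture.Theorems.EIHFluxBalanceInertialRecessionStubSlaving3FarFieldPrep
import Summits.FinalStateConjecture.FinalStateConjecture.Theorems.EIHFluxBalanceInertialRecessionStubSlavingCOERCompactBoosts

/-!
# Route EIHFluxBalance — `InertialRecession` (E′), line `SketchCleanExcision`, skeleton r13,
# stub `stub_higherOrderSlaving` (EF): the Kerr–Schild summand as a smooth function of
# (spin, frame, rest position)

Helper file for the crux `stmt-FinalStateConjecture-17403`
(`Summit.FinalStateConjecture.FinalStateConjecture.Theses.EIHFluxBalance.InertialRecession`, E′),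
registered stub `stub_higherOrderSlaving` (orders two and three of frozen-vacuum slaving).

Every painted summand of the modulated ansatz is a value of ONE smooth master function
`ω(a', S, w) = (g_{1,a'}(S w) − η)(S·, S·)` of the spin `a'`, the frame `S : E4 →L E4` and the
rest-frame position `w` (local notation `(fun p : ℝ × (E4 →L[ℝ] E4) × E4 ↦ (Kerr.bilin 1 p.1 (p.2.1 p.2.2) - Minkowski.bilin).bilinearComp p.2.1 p.2.1)`, domain `{p : ℝ × (E4 →L[ℝ] E4) × E4 | 0 < Kerr.radius p.1 (p.2.1 p.2.2)} = {r_{a'}(S w) > 0}`):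

* `higherOrder_boostedKerrBilin_sub_eq_omega` — `boostedKerrBilin L c M a z − η = M • ω(a, L⁻¹, z − c)`
  (mass homogeneity `Kerr.ksPert_smul`, `η`-invariance of `L⁻¹`);
* `higherOrder_omega_scaling` — `ω(a', S, w) = ρ⁻¹ • ω(a'/ρ, S, w/ρ)` (Kerr–Schild scaling), which
  turns far-field bounds into near-field bounds for rescaled parameters;
* `higherOrder_contDiffOn_omega`, `higherOrder_isOpen_omegaDomain` — joint smoothness
  (`Kerr.contDiffAt_ksPert₂`);
* `higherOrder_fderiv_omega_frameDir` — the derivative in a frame/position direction `(0, T, ω₀)`: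
  `Dω(a', S, w)(0, T, ω₀) = (D(g_{1,a'} − η)(Sw)[T w + S ω₀])(S·,S·) + (g−η)(Sw)(T·, S·) + (g−η)(Sw)(S·, T·)`;
* `higherOrder_smul_fderiv_omega_eq_var` — for `T = A ∘ L⁻¹` with `A` `η`-skew and `ω₀ = L d` this
  is (after multiplication by `M`) EXACTLY the first-variation form of the registered coercivity
  statement `stub_coerSymbolQuant`;
* `higherOrder_isCompact_omegaBox`, `higherOrder_exists_omega_bounds` — the compact parameter box
  `{|a'| ≤ α₀, S ∈ O(1,3) with |(Se₀)⁰| ≤ γ, ‖w‖ ≤ R', r ≥ r₁}` inside `{p : ℝ × (E4 →L[ℝ] E4) × E4 | 0 < Kerr.radius p.1 (p.2.1 p.2.2)}` and uniform bounds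
  on `Dᵏω`, `k ≤ 3`, there.

No definitions, no notation, no named facts, no `sorry`.
-/

set_option linter.dupNamespace false
set_option maxSynthPendingDepth 6
set_option synthInstance.maxHeartbeats 200000

noncomputable section

namespace Summit.FinalStateConjecture.FinalStateConjecture.Theorems.SublinearIsFree.Slaving

open scoped Topology ContDiff
open Filter Set Function Metric Literature.Geometry.Lorentzian

/-! ### Algebra: mass homogeneity, the painting identity, scaling -/

/-- Mass homogeneity of the Kerr–Schild perturbation: `g_{M,a} − η = M • (g_{1,a} − η)`. [folklore] -/
theorem higherOrder_ksPert_eq_mass_smul (M a : ℝ) (y : E4) :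
    Kerr.bilin M a y - Minkowski.bilin = M • (Kerr.bilin 1 a y - Minkowski.bilin) := by
  have h := Kerr.ksPert_smul (ε := 1) one_pos M a y
  simpa using h

/-- Scalar multiples pass through `bilinearComp`. [folklore] -/
theorem higherOrder_smul_bilinearComp (c : ℝ) (T : E4 →L[ℝ] E4 →L[ℝ] ℝ) (A B : E4 →L[ℝ] E4) :
    (c • T).bilinearComp A B = c • T.bilinearComp A B := by
  ext v w; rfl

/-- Differences pass through `bilinearComp`. [folklore] -/
theorem higherOrder_sub_bilinearComp (T T' : E4 →L[ℝ] E4 →L[ℝ] ℝ) (A B : E4 →L[ℝ] E4) :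
    (T - T').bilinearComp A B = T.bilinearComp A B - T'.bilinearComp A B := by
  ext v w; rfl

/-- `η(L⁻¹ ·, L⁻¹ ·) = η` for a Lorentz transformation. [folklore] -/
theorem higherOrder_minkowski_bilinearComp_symm (L : lorentzGroup) :
    (Minkowski.bilin : E4 →L[ℝ] E4 →L[ℝ] ℝ).bilinearComp (((L : E4 ≃L[ℝ] E4).symm : E4 →L[ℝ] E4))
      (((L : E4 ≃L[ℝ] E4).symm : E4 →L[ℝ] E4)) = Minkowski.bilin := by
  ext v w
  simp only [ContinuousLinearMap.bilinearComp_apply, ContinuousLinearEquiv.coe_coe]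
  have h := L.2 ((L : E4 ≃L[ℝ] E4).symm v) ((L : E4 ≃L[ℝ] E4).symm w)
  rw [ContinuousLinearEquiv.apply_symm_apply, ContinuousLinearEquiv.apply_symm_apply] at h
  exact h.symm

/-- **The painting identity**: `boostedKerrBilin L c M a z − η = M • ω(a, L⁻¹, z − c)`. [folklore] -/
theorem higherOrder_boostedKerrBilin_sub_eq_omega (L : lorentzGroup) (c : E4) (M a : ℝ) (z : E4) :
    boostedKerrBilin L c M a z - Minkowski.bilin =
      M • (fun p : ℝ × (E4 →L[ℝ] E4) × E4 ↦ (Kerr.bilin 1 p.1 (p.2.1 p.2.2) - Minkowski.bilin).bilinearComp p.2.1 p.2.1) (a, (((L : E4 ≃L[ℝ] E4).symm : E4 →L[ℝ] E4)), z - c) := by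
  have hb : boostedKerrBilin L c M a z = (Kerr.bilin M a (poincareInv L c z)).bilinearComp
      (((L : E4 ≃L[ℝ] E4).symm : E4 →L[ℝ] E4)) (((L : E4 ≃L[ℝ] E4).symm : E4 →L[ℝ] E4)) := by
    ext v w; rfl
  have hp : poincareInv L c z = ((L : E4 ≃L[ℝ] E4).symm : E4 →L[ℝ] E4) (z - c) := rfl
  simp only []
  rw [hb, ← higherOrder_smul_bilinearComp, ← higherOrder_ksPert_eq_mass_smul, hp,
    higherOrder_sub_bilinearComp, higherOrder_minkowski_bilinearComp_symm]

/-- **Kerr–Schild scaling of the master function**: `ω(a', S, w) = ρ⁻¹ • ω(a'/ρ, S, w/ρ)` for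
`ρ > 0`. [folklore] -/
theorem higherOrder_omega_scaling (a' : ℝ) (S : E4 →L[ℝ] E4) (w : E4) {ρ : ℝ} (hρ : 0 < ρ) :
    (fun p : ℝ × (E4 →L[ℝ] E4) × E4 ↦ (Kerr.bilin 1 p.1 (p.2.1 p.2.2) - Minkowski.bilin).bilinearComp p.2.1 p.2.1) (a', S, w) = ρ⁻¹ • (fun p : ℝ × (E4 →L[ℝ] E4) × E4 ↦ (Kerr.bilin 1 p.1 (p.2.1 p.2.2) - Minkowski.bilin).bilinearComp p.2.1 p.2.1) (ρ⁻¹ * a', S, ρ⁻¹ • w) := by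
  have h := Kerr.ksPert_smul (ε := ρ⁻¹) (inv_pos.2 hρ) 1 a' (S w)
  simp only [mul_one] at h
  show (Kerr.bilin 1 a' (S w) - Minkowski.bilin).bilinearComp S S =
    ρ⁻¹ • (Kerr.bilin 1 (ρ⁻¹ * a') (S (ρ⁻¹ • w)) - Minkowski.bilin).bilinearComp S S
  rw [map_smul, h, higherOrder_smul_bilinearComp]

/-! ### Smoothness -/

/-- The evaluation map `(a', S, w) ↦ (a', S w)` is smooth. [folklore] -/
theorem higherOrder_contDiff_omegaArg :
    ContDiff ℝ ∞ (fun p : ℝ × (E4 →L[ℝ] E4) × E4 ↦ ((p.1, p.2.1 p.2.2) : ℝ × E4)) := by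
  refine contDiff_fst.prodMk ?_
  have h : ContDiff ℝ ∞ (fun q : (E4 →L[ℝ] E4) × E4 ↦ q.1 q.2) := isBoundedBilinearMap_apply.contDiff
  exact h.comp contDiff_snd

/-- The rest radius `(a', S, w) ↦ r_{a'}(S w)` is continuous. [folklore] -/
theorem higherOrder_continuous_omegaRadius :
    Continuous (fun p : ℝ × (E4 →L[ℝ] E4) × E4 ↦ Kerr.radius p.1 (p.2.1 p.2.2)) := by
  have h1 : Continuous (fun q : ℝ × E4 ↦ Kerr.radius q.1 q.2) := by
    unfold Kerr.radius E4.spatialNorm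
    fun_prop
  have h := h1.comp higherOrder_contDiff_omegaArg.continuous
  exact h

/-- The domain of the master function is open. [folklore] -/
theorem higherOrder_isOpen_omegaDomain : IsOpen {p : ℝ × (E4 →L[ℝ] E4) × E4 | 0 < Kerr.radius p.1 (p.2.1 p.2.2)} :=
  isOpen_lt continuous_const higherOrder_continuous_omegaRadius

/-- **The master function is smooth on its domain** (joint smoothness of `(a, y) ↦ g_{1,a}(y) − η`
where `r > 0`, `Kerr.contDiffAt_ksPert₂`, composed with `(a', S, w) ↦ (a', S w)` and the frame
factors). [folklore] -/
theorem higherOrder_contDiffOn_omega : ContDiffOn ℝ ∞ (fun p : ℝ × (E4 →L[ℝ] E4) × E4 ↦ (Kerr.bilin 1 p.1 (p.2.1 p.2.2) - Minkowski.bilin).bilinearComp p.2.1 p.2.1) {p : ℝ × (E4 →L[ℝ] E4) × E4 | 0 < Kerr.radius p.1 (p.2.1 p.2.2)} := by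
  intro p hp
  have hK : ContDiffAt ℝ ∞ (fun p : ℝ × (E4 →L[ℝ] E4) × E4 ↦
      Kerr.bilin 1 p.1 (p.2.1 p.2.2) - Minkowski.bilin) p := by
    have h := (Kerr.contDiffAt_ksPert₂ (p := (p.1, p.2.1 p.2.2)) hp (n := ∞)).comp p
      higherOrder_contDiff_omegaArg.contDiffAt
    exact h
  have hS : ContDiffAt ℝ ∞ (fun p : ℝ × (E4 →L[ℝ] E4) × E4 ↦ p.2.1) p :=
    (contDiff_fst.comp contDiff_snd).contDiffAt
  have h := contDiffWithinAt_bilinearComp_self (s := Set.univ) hK.contDiffWithinAt hS.contDiffWithinAt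
  exact h.mono (subset_univ _)

/-! ### The derivative in a frame/position direction -/

set_option maxHeartbeats 1600000 in
/-- **The derivative of the master function in the direction `(0, T, ω₀)`**:
`Dω(a', S, w)(0, T, ω₀) = (D(g_{1,a'} − η)(Sw)[T w + S ω₀])(S·, S·) + (g−η)(Sw)(T·, S·) + (g−η)(Sw)(S·, T·)`
(product rule along the line `τ ↦ (a', S + τT, w + τω₀)`). [folklore] -/
theorem higherOrder_fderiv_omega_frameDir {a' : ℝ} {S : E4 →L[ℝ] E4} {w : E4}
    (hp : 0 < Kerr.radius a' (S w)) (T : E4 →L[ℝ] E4) (ω₀ : E4) :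
    fderiv ℝ (fun p : ℝ × (E4 →L[ℝ] E4) × E4 ↦ (Kerr.bilin 1 p.1 (p.2.1 p.2.2) - Minkowski.bilin).bilinearComp p.2.1 p.2.1) (a', S, w) ((0 : ℝ), T, ω₀) =
      (fderiv ℝ (fun y ↦ Kerr.bilin 1 a' y - Minkowski.bilin) (S w) (T w + S ω₀)).bilinearComp S S +
      (Kerr.bilin 1 a' (S w) - Minkowski.bilin).bilinearComp T S +
      (Kerr.bilin 1 a' (S w) - Minkowski.bilin).bilinearComp S T := by
  set p : ℝ × (E4 →L[ℝ] E4) × E4 := (a', S, w) with hpdef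
  set q : ℝ × (E4 →L[ℝ] E4) × E4 := ((0 : ℝ), T, ω₀) with hqdef
  set h : E4 → E4 →L[ℝ] E4 →L[ℝ] ℝ := fun y ↦ Kerr.bilin 1 a' y - Minkowski.bilin with hh
  -- differentiability of `ω` at `p` and the derivative along the line
  have hpΩ : p ∈ {p : ℝ × (E4 →L[ℝ] E4) × E4 | 0 < Kerr.radius p.1 (p.2.1 p.2.2)} := hp
  have hω : DifferentiableAt ℝ (fun p : ℝ × (E4 →L[ℝ] E4) × E4 ↦ (Kerr.bilin 1 p.1 (p.2.1 p.2.2) - Minkowski.bilin).bilinearComp p.2.1 p.2.1) p :=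
    (higherOrder_contDiffOn_omega.contDiffAt (higherOrder_isOpen_omegaDomain.mem_nhds hpΩ)).differentiableAt
      (by simp)
  have hline : HasDerivAt (fun τ : ℝ ↦ p + τ • q) q 0 := by
    simpa using ((hasDerivAt_id (0 : ℝ)).smul_const q).const_add p
  have hchain : HasDerivAt (fun τ : ℝ ↦ (fun p : ℝ × (E4 →L[ℝ] E4) × E4 ↦ (Kerr.bilin 1 p.1 (p.2.1 p.2.2) - Minkowski.bilin).bilinearComp p.2.1 p.2.1) (p + τ • q)) (fderiv ℝ (fun p : ℝ × (E4 →L[ℝ] E4) × E4 ↦ (Kerr.bilin 1 p.1 (p.2.1 p.2.2) - Minkowski.bilin).bilinearComp p.2.1 p.2.1) p q) 0 := by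
    have hω' : HasFDerivAt (fun p : ℝ × (E4 →L[ℝ] E4) × E4 ↦ (Kerr.bilin 1 p.1 (p.2.1 p.2.2) - Minkowski.bilin).bilinearComp p.2.1 p.2.1) (fderiv ℝ (fun p : ℝ × (E4 →L[ℝ] E4) × E4 ↦ (Kerr.bilin 1 p.1 (p.2.1 p.2.2) - Minkowski.bilin).bilinearComp p.2.1 p.2.1) p) (p + (0 : ℝ) • q) := by
      rw [zero_smul, add_zero]; exact hω.hasFDerivAt
    exact hω'.comp_hasDerivAt (0 : ℝ) hline
  -- the same function, computed along the line by the product rule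
  have hd : DifferentiableAt ℝ h (S w) :=
    ((Kerr.contDiffAt_bilin 1 a' hp (n := ∞)).sub contDiffAt_const).differentiableAt (by simp)
  have hA : HasDerivAt (fun τ : ℝ ↦ S + τ • T) T 0 := by
    simpa using ((hasDerivAt_id (0 : ℝ)).smul_const T).const_add S
  have hu : HasDerivAt (fun τ : ℝ ↦ w + τ • ω₀) ω₀ 0 := by
    simpa using ((hasDerivAt_id (0 : ℝ)).smul_const ω₀).const_add w
  have hy : HasDerivAt (fun τ : ℝ ↦ (S + τ • T) (w + τ • ω₀)) (T w + S ω₀) 0 := by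
    have h1 := hA.clm_apply hu
    simpa using h1
  have hT : HasDerivAt (fun τ : ℝ ↦ h ((S + τ • T) (w + τ • ω₀))) (fderiv ℝ h (S w) (T w + S ω₀)) 0 := by
    have hd' : HasFDerivAt h (fderiv ℝ h (S w)) ((S + (0 : ℝ) • T) (w + (0 : ℝ) • ω₀)) := by
      simp only [zero_smul, add_zero]; exact hd.hasFDerivAt
    exact hd'.comp_hasDerivAt (0 : ℝ) hy
  -- `T(A·, A·) = (compL.flip A) ∘ (T ∘ A)`
  set Lf : (E4 →L[ℝ] E4) →L[ℝ] (E4 →L[ℝ] ℝ) →L[ℝ] (E4 →L[ℝ] ℝ) :=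
    (ContinuousLinearMap.compL ℝ E4 E4 ℝ).flip with hLf
  have hF : HasDerivAt (fun τ : ℝ ↦ (Lf (S + τ • T)).comp ((h ((S + τ • T) (w + τ • ω₀))).comp (S + τ • T)))
      ((Lf T).comp ((h (S w)).comp S) +
        (Lf S).comp ((fderiv ℝ h (S w) (T w + S ω₀)).comp S + (h (S w)).comp T)) 0 := by
    have h1 : HasDerivAt (fun τ : ℝ ↦ Lf (S + τ • T)) (Lf T) 0 :=
      Lf.hasFDerivAt.comp_hasDerivAt (0 : ℝ) hA
    have h2 : HasDerivAt (fun τ : ℝ ↦ (h ((S + τ • T) (w + τ • ω₀))).comp (S + τ • T))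
        ((fderiv ℝ h (S w) (T w + S ω₀)).comp S + (h (S w)).comp T) 0 := by
      have := hT.clm_comp hA
      simpa using this
    have h3 := h1.clm_comp h2
    simpa using h3
  have hfun : (fun τ : ℝ ↦ (fun p : ℝ × (E4 →L[ℝ] E4) × E4 ↦ (Kerr.bilin 1 p.1 (p.2.1 p.2.2) - Minkowski.bilin).bilinearComp p.2.1 p.2.1) (p + τ • q)) =
      fun τ : ℝ ↦ (Lf (S + τ • T)).comp ((h ((S + τ • T) (w + τ • ω₀))).comp (S + τ • T)) := by
    funext τ
    have hpq : p + τ • q = (a', S + τ • T, w + τ • ω₀) := by simp [hpdef, hqdef]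
    rw [hpq]
    exact bilinearComp_self_eq_comp _ _
  rw [hfun] at hchain
  have heq := hchain.unique hF
  have hcomp : ∀ (X : E4 →L[ℝ] E4 →L[ℝ] ℝ) (A B : E4 →L[ℝ] E4),
      (Lf B).comp (X.comp A) = X.bilinearComp A B := fun X A B ↦ by
    ext v u; rfl
  rw [heq, ContinuousLinearMap.comp_add, hcomp, hcomp, hcomp]
  abel

/-! ### Identification with the first-variation form of the coercivity statement -/

/-- **`M • Dω(a, L⁻¹, z)(0, A∘L⁻¹, L d)` is the first-variation form** of `stub_coerSymbolQuant` /
`stub_coerMomQuant` (with `poincareInv L 0 z = L⁻¹ z`), for `η`-skew `A`: the two `η`-terms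
`η(AL⁻¹·, L⁻¹·) + η(L⁻¹·, AL⁻¹·)` produced by differentiating the frame factors cancel by
skewness. [folklore] -/
theorem higherOrder_smul_fderiv_omega_eq_var (L : lorentzGroup) {A : E4 →L[ℝ] E4}
    (hA : ∀ u w : E4, Minkowski.bilin (A u) w + Minkowski.bilin u (A w) = 0) (d : E4) (M a : ℝ)
    (z : E4) (hz : 0 < Kerr.radius a (poincareInv L 0 z)) :
    M • fderiv ℝ (fun p : ℝ × (E4 →L[ℝ] E4) × E4 ↦ (Kerr.bilin 1 p.1 (p.2.1 p.2.2) - Minkowski.bilin).bilinearComp p.2.1 p.2.1) (a, (((L : E4 ≃L[ℝ] E4).symm : E4 →L[ℝ] E4)), z)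
      ((0 : ℝ), A.comp (((L : E4 ≃L[ℝ] E4).symm : E4 →L[ℝ] E4)), (L : E4 ≃L[ℝ] E4) d) =
    (fderiv ℝ (Kerr.bilin M a) (poincareInv L 0 z) (A (poincareInv L 0 z) + d)).bilinearComp
        (((L : E4 ≃L[ℝ] E4).symm : E4 →L[ℝ] E4)) (((L : E4 ≃L[ℝ] E4).symm : E4 →L[ℝ] E4)) +
      (Kerr.bilin M a (poincareInv L 0 z)).bilinearComp (A.comp (((L : E4 ≃L[ℝ] E4).symm : E4 →L[ℝ] E4)))
        (((L : E4 ≃L[ℝ] E4).symm : E4 →L[ℝ] E4)) +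
      (Kerr.bilin M a (poincareInv L 0 z)).bilinearComp (((L : E4 ≃L[ℝ] E4).symm : E4 →L[ℝ] E4))
        (A.comp (((L : E4 ≃L[ℝ] E4).symm : E4 →L[ℝ] E4))) := by
  set S : E4 →L[ℝ] E4 := (((L : E4 ≃L[ℝ] E4).symm : E4 →L[ℝ] E4)) with hS
  have hy : poincareInv L 0 z = S z := by simp [poincareInv, hS]
  rw [hy] at hz ⊢
  rw [higherOrder_fderiv_omega_frameDir hz]
  have hSd : S ((L : E4 ≃L[ℝ] E4) d) = d := by simp [hS]
  rw [ContinuousLinearMap.comp_apply, hSd]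
  -- the derivative of `g_{M,a}` is `M •` that of `g_{1,a} − η`
  have hdiff : DifferentiableAt ℝ (fun y ↦ Kerr.bilin 1 a y - Minkowski.bilin) (S z) :=
    ((Kerr.contDiffAt_bilin 1 a hz (n := ∞)).sub contDiffAt_const).differentiableAt (by simp)
  have hfd : fderiv ℝ (Kerr.bilin M a) (S z) =
      M • fderiv ℝ (fun y ↦ Kerr.bilin 1 a y - Minkowski.bilin) (S z) := by
    have hfun : Kerr.bilin M a = fun y ↦ M • (Kerr.bilin 1 a y - Minkowski.bilin) + Minkowski.bilin := by
      funext y; rw [← higherOrder_ksPert_eq_mass_smul, sub_add_cancel]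
    rw [hfun, fderiv_add_const]
    exact (hdiff.hasFDerivAt.const_smul M).fderiv
  have hval : Kerr.bilin M a (S z) = M • (Kerr.bilin 1 a (S z) - Minkowski.bilin) + Minkowski.bilin := by
    rw [← higherOrder_ksPert_eq_mass_smul, sub_add_cancel]
  -- the `η` terms cancel by skewness
  have hη : (Minkowski.bilin : E4 →L[ℝ] E4 →L[ℝ] ℝ).bilinearComp (A.comp S) S +
      (Minkowski.bilin : E4 →L[ℝ] E4 →L[ℝ] ℝ).bilinearComp S (A.comp S) = 0 := by
    ext v u
    simp only [_root_.add_apply, ContinuousLinearMap.bilinearComp_apply, ContinuousLinearMap.coe_comp,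
      Function.comp_apply, _root_.zero_apply]
    exact hA (S v) (S u)
  have hadd : ∀ (T T' : E4 →L[ℝ] E4 →L[ℝ] ℝ) (A B : E4 →L[ℝ] E4),
      (T + T').bilinearComp A B = T.bilinearComp A B + T'.bilinearComp A B := fun T T' A B ↦ by
    ext v w; rfl
  rw [hfd, hval, smul_add, smul_add, ← higherOrder_smul_bilinearComp, ← higherOrder_smul_bilinearComp,
    ← higherOrder_smul_bilinearComp, _root_.smul_apply, hadd, hadd]
  have e := hη
  rw [← sub_eq_zero]
  have : ∀ (X Y Z P Q : E4 →L[ℝ] E4 →L[ℝ] ℝ), P + Q = 0 →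
      X + Y + Z - (X + (Y + P) + (Z + Q)) = 0 := by
    intro X Y Z P Q hPQ
    have : X + Y + Z - (X + (Y + P) + (Z + Q)) = -(P + Q) := by abel
    rw [this, hPQ, neg_zero]
  exact this _ _ _ _ _ e

/-! ### The compact parameter box and uniform bounds -/

/-- **The parameter box is compact**: `{|a'| ≤ α₀} × {S ∈ O(1,3), |(Se₀)⁰| ≤ γ} × {‖w‖ ≤ R'}`
intersected with the closed condition `r_{a'}(Sw) ≥ r₁`. [folklore] -/
theorem higherOrder_isCompact_omegaBox (α₀ γ R' r₁ : ℝ) :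
    IsCompact {p : ℝ × (E4 →L[ℝ] E4) × E4 | |p.1| ≤ α₀ ∧
      ((∀ v w, Minkowski.bilin (p.2.1 v) (p.2.1 w) = Minkowski.bilin v w) ∧
        |p.2.1 (E4.basisVector 0) 0| ≤ γ) ∧ ‖p.2.2‖ ≤ R' ∧ r₁ ≤ Kerr.radius p.1 (p.2.1 p.2.2)} := by
  have hK : IsCompact ((Icc (-α₀) α₀ : Set ℝ) ×ˢ ({L : E4 →L[ℝ] E4 |
      (∀ v w, Minkowski.bilin (L v) (L w) = Minkowski.bilin v w) ∧ |L (E4.basisVector 0) 0| ≤ γ} ×ˢ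
        closedBall (0 : E4) R')) :=
    isCompact_Icc.prod ((isCompact_lorentzBounded γ).prod (isCompact_closedBall _ _))
  have hc := higherOrder_continuous_omegaRadius
  have hA : IsClosed {p : ℝ × (E4 →L[ℝ] E4) × E4 | |p.1| ≤ α₀} :=
    isClosed_le (continuous_abs.comp continuous_fst) continuous_const
  have hB : IsClosed {p : ℝ × (E4 →L[ℝ] E4) × E4 |
      (∀ v w, Minkowski.bilin (p.2.1 v) (p.2.1 w) = Minkowski.bilin v w) ∧
        |p.2.1 (E4.basisVector 0) 0| ≤ γ} :=
    (isClosed_lorentzBounded γ).preimage (continuous_fst.comp continuous_snd)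
  have hC : IsClosed {p : ℝ × (E4 →L[ℝ] E4) × E4 | ‖p.2.2‖ ≤ R'} :=
    isClosed_le (continuous_norm.comp (continuous_snd.comp continuous_snd)) continuous_const
  have hD : IsClosed {p : ℝ × (E4 →L[ℝ] E4) × E4 | r₁ ≤ Kerr.radius p.1 (p.2.1 p.2.2)} :=
    isClosed_le continuous_const hc
  have hcl : IsClosed {p : ℝ × (E4 →L[ℝ] E4) × E4 | |p.1| ≤ α₀ ∧
      ((∀ v w, Minkowski.bilin (p.2.1 v) (p.2.1 w) = Minkowski.bilin v w) ∧
        |p.2.1 (E4.basisVector 0) 0| ≤ γ) ∧ ‖p.2.2‖ ≤ R' ∧ r₁ ≤ Kerr.radius p.1 (p.2.1 p.2.2)} :=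
    hA.inter (hB.inter (hC.inter hD))
  refine hK.of_isClosed_subset hcl fun p hp ↦ ?_
  exact ⟨abs_le.1 hp.1, hp.2.1, mem_closedBall_zero_iff.2 hp.2.2.1⟩

/-- The parameter box lies in the domain of the master function when `r₁ > 0`. [folklore] -/
theorem higherOrder_omegaBox_subset_domain (α₀ γ R' : ℝ) {r₁ : ℝ} (hr₁ : 0 < r₁) :
    {p : ℝ × (E4 →L[ℝ] E4) × E4 | |p.1| ≤ α₀ ∧
      ((∀ v w, Minkowski.bilin (p.2.1 v) (p.2.1 w) = Minkowski.bilin v w) ∧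
        |p.2.1 (E4.basisVector 0) 0| ≤ γ) ∧ ‖p.2.2‖ ≤ R' ∧ r₁ ≤ Kerr.radius p.1 (p.2.1 p.2.2)} ⊆ {p : ℝ × (E4 →L[ℝ] E4) × E4 | 0 < Kerr.radius p.1 (p.2.1 p.2.2)} :=
  fun _ hp ↦ hr₁.trans_le hp.2.2.2

/-- **Uniform bounds for the master function and its first three derivatives on the parameter
box.** [folklore] -/
theorem higherOrder_exists_omega_bounds (α₀ γ R' : ℝ) {r₁ : ℝ} (hr₁ : 0 < r₁) :
    ∃ C : ℝ, 0 ≤ C ∧ ∀ p ∈ {p : ℝ × (E4 →L[ℝ] E4) × E4 | |p.1| ≤ α₀ ∧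
      ((∀ v w, Minkowski.bilin (p.2.1 v) (p.2.1 w) = Minkowski.bilin v w) ∧
        |p.2.1 (E4.basisVector 0) 0| ≤ γ) ∧ ‖p.2.2‖ ≤ R' ∧ r₁ ≤ Kerr.radius p.1 (p.2.1 p.2.2)},
      ∀ i ≤ 3, ‖iteratedFDeriv ℝ i (fun p : ℝ × (E4 →L[ℝ] E4) × E4 ↦ (Kerr.bilin 1 p.1 (p.2.1 p.2.2) - Minkowski.bilin).bilinearComp p.2.1 p.2.1) p‖ ≤ C :=
  exists_forall_norm_iteratedFDeriv_le_of_isCompact higherOrder_isOpen_omegaDomain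
    higherOrder_contDiffOn_omega (higherOrder_isCompact_omegaBox α₀ γ R' r₁)
    (higherOrder_omegaBox_subset_domain α₀ γ R' hr₁) 3

/-- **Registered one-line carrier form** (`higherOrder_omegaFrameDir_EF`) of
`higherOrder_fderiv_omega_frameDir`: the derivative of the Kerr–Schild master function in a
frame/position direction. [folklore] -/
theorem higherOrder_omegaFrameDir_EF : open Literature.Geometry.Lorentzian in ∀ {a' : ℝ} {S : E4 →L[ℝ] E4} {w : E4}, 0 < Kerr.radius a' (S w) → ∀ (T : E4 →L[ℝ] E4) (ω₀ : E4), fderiv ℝ (fun p : ℝ × (E4 →L[ℝ] E4) × E4 ↦ (Kerr.bilin 1 p.1 (p.2.1 p.2.2) - Minkowski.bilin).bilinearComp p.2.1 p.2.1) (a', S, w) ((0 : ℝ), T, ω₀) = (fderiv ℝ (fun y ↦ Kerr.bilin 1 a' y - Minkowski.bilin) (S w) (T w + S ω₀)).bilinearComp S S + (Kerr.bilin 1 a' (S w) - Minkowski.bilin).bilinearComp T S + (Kerr.bilin 1 a' (S w) - Minkowski.bilin).bilinearComp S T :=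
  fun hp T ω₀ ↦ higherOrder_fderiv_omega_frameDir hp T ω₀

end Summit.FinalStateConjecture.FinalStateConjecture.Theorems.SublinearIsFree.Slaving

end
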